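import Mathlib.Analysis.Calculus.Deriv.MeanValue
import Mathlib.MeasureTheory.Measure.Lebesgue.Basic
import Mathlib.Topology.EMetricSpace.Diam
import HarnessLib

/-!
# Sublevel set estimates (van der Corput type), first and second order

Topic `Literature/Analysis/Fourier`; the measure-theoretic companion of `VanDerCorput.lean`.
The classical sublevel set lemma (Christ 1985; Carbery–Christ–Wright 1999, §2; it is the
`k = 1, 2` case of "if `|φ^{(k)}| ≥ λ` on an interval `I` then `|{x ∈ I : |φ(x)| ≤ s}| ≤ C_k (s/λ)^{1/k}`"):

* `volume_sublevel_le_of_le_deriv` — if `f' ≥ τ > 0` on a convex set `D ⊆ ℝ` then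
  `vol {x ∈ D | |f x| < s} ≤ 2s/τ`; `volume_sublevel_le_of_deriv_le` — the same for `f' ≤ -τ`;
  `volume_sublevel_le_of_le_abs_deriv` — for `|f'| ≥ τ` with `f'` continuous on `D`;
* `volume_sublevel_le_of_le_deriv2` — **if `f'' ≥ c > 0` on `D` then
  `vol {x ∈ D | |f x| < s} ≤ 6 √(s/c)`** (split `D` into `{f' ≤ -τ}`, `{|f'| < τ}`,
  `{f' ≥ τ}` with `τ = √(sc)`); `volume_sublevel_le_of_le_abs_deriv2` — for `|f''| ≥ c` with
  `f''` continuous.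

Hypotheses are stated with explicit derivative functions (`HasDerivAt` at every point of `D`).
Everything is proved. [folklore]
-/

noncomputable section

open Real Set MeasureTheory MeasureTheory.Measure

namespace Literature.Analysis.Fourier

/-! ### First order -/

/-- **First-order sublevel estimate**: if `f' ≥ τ > 0` on a convex `D ⊆ ℝ`, then
`vol {x ∈ D | |f x| < s} ≤ 2s/τ` (two points of the set are at distance `< 2s/τ` by the mean
value inequality). [folklore] -/
theorem volume_sublevel_le_of_le_deriv {D : Set ℝ} (hD : Convex ℝ D) {f f' : ℝ → ℝ}
    (hf : ∀ x ∈ D, HasDerivAt f (f' x) x) {τ : ℝ} (hτ : 0 < τ) (hle : ∀ x ∈ D, τ ≤ f' x) (s : ℝ) :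
    volume {x ∈ D | |f x| < s} ≤ ENNReal.ofReal (2 * s / τ) := by
  set S : Set ℝ := {x ∈ D | |f x| < s} with hS
  -- two points of `S` are within `2s/τ`
  have hdist : ∀ x ∈ S, ∀ y ∈ S, x ≤ y → y - x ≤ 2 * s / τ := by
    intro x hx y hy hxy
    have hcont : ContinuousOn f D := fun z hz => (hf z hz).continuousAt.continuousWithinAt
    have hdiff : DifferentiableOn ℝ f (interior D) := fun z hz =>
      (hf z (interior_subset hz)).differentiableAt.differentiableWithinAt
    have hge : ∀ z ∈ interior D, τ ≤ deriv f z := fun z hz => by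
      rw [(hf z (interior_subset hz)).deriv]; exact hle z (interior_subset hz)
    have hmv := hD.mul_sub_le_image_sub_of_le_deriv hcont hdiff hge x hx.1 y hy.1 hxy
    have h1 := (abs_lt.1 hx.2).1
    have h2 := (abs_lt.1 hy.2).2
    rw [le_div_iff₀ hτ]
    nlinarith
  calc volume S ≤ Metric.ediam S := Real.volume_le_diam S
    _ ≤ ENNReal.ofReal (2 * s / τ) := by
        refine Metric.ediam_le fun x hx y hy => ?_
        rw [edist_dist, Real.dist_eq]
        refine ENNReal.ofReal_le_ofReal ?_
        rcases le_total x y with h | h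
        · rw [abs_sub_comm, abs_of_nonneg (by linarith)]; exact hdist x hx y hy h
        · rw [abs_of_nonneg (by linarith)]; exact hdist y hy x hx h

/-- First-order sublevel estimate, decreasing case: `f' ≤ -τ < 0` on `D`. [folklore] -/
theorem volume_sublevel_le_of_deriv_le {D : Set ℝ} (hD : Convex ℝ D) {f f' : ℝ → ℝ}
    (hf : ∀ x ∈ D, HasDerivAt f (f' x) x) {τ : ℝ} (hτ : 0 < τ) (hle : ∀ x ∈ D, f' x ≤ -τ) (s : ℝ) :
    volume {x ∈ D | |f x| < s} ≤ ENNReal.ofReal (2 * s / τ) := by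
  have h := volume_sublevel_le_of_le_deriv hD (f := fun x => -f x) (f' := fun x => -f' x)
    (fun x hx => (hf x hx).neg) hτ (fun x hx => by linarith [hle x hx]) s
  have hset : {x ∈ D | |(fun x => -f x) x| < s} = {x ∈ D | |f x| < s} := by
    ext x; simp only [mem_setOf_eq, abs_neg]
  rwa [hset] at h

/-- First-order sublevel estimate for `|f'| ≥ τ` with `f'` continuous on `D` (so that `f'` has a
constant sign on the convex `D`). [folklore] -/
theorem volume_sublevel_le_of_le_abs_deriv {D : Set ℝ} (hD : Convex ℝ D) {f f' : ℝ → ℝ}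
    (hf : ∀ x ∈ D, HasDerivAt f (f' x) x) (hf'c : ContinuousOn f' D) {τ : ℝ} (hτ : 0 < τ)
    (hle : ∀ x ∈ D, τ ≤ |f' x|) (s : ℝ) :
    volume {x ∈ D | |f x| < s} ≤ ENNReal.ofReal (2 * s / τ) := by
  -- `f'` does not vanish on the preconnected `D`, hence has a constant sign
  rcases D.eq_empty_or_nonempty with hDe | ⟨x₀, hx₀⟩
  · have : {x ∈ D | |f x| < s} = ∅ := by rw [hDe]; ext; simp
    rw [this, measure_empty]; exact bot_le
  have hpre : IsPreconnected D := hD.isPreconnected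
  have hsign : (∀ x ∈ D, τ ≤ f' x) ∨ (∀ x ∈ D, f' x ≤ -τ) := by
    rcases le_or_gt 0 (f' x₀) with h0 | h0
    · left
      intro x hx
      have hx' := hle x hx
      by_contra hneg
      push Not at hneg
      -- `f' x < τ ≤ |f' x|` forces `f' x < 0 ≤ f' x₀`: IVT gives a zero of `f'` on `D`
      have hfx : f' x < 0 := by
        rcases le_or_gt 0 (f' x) with h | h
        · rw [abs_of_nonneg h] at hx'; exact absurd hx' (not_le.2 hneg)
        · exact h
      obtain ⟨z, hz, hz0⟩ := hpre.intermediate_value₂ hx hx₀ hf'c continuousOn_const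
        hfx.le h0
      have := hle z hz
      rw [hz0, abs_zero] at this
      exact absurd this (not_le.2 hτ)
    · right
      intro x hx
      have hx' := hle x hx
      by_contra hneg
      push Not at hneg
      have hfx : 0 < f' x := by
        rcases le_or_gt (f' x) 0 with h | h
        · rw [abs_of_nonpos h] at hx'; linarith
        · exact h
      obtain ⟨z, hz, hz0⟩ := hpre.intermediate_value₂ hx₀ hx hf'c continuousOn_const
        h0.le hfx.le
      have := hle z hz
      rw [hz0, abs_zero] at this
      exact absurd this (not_le.2 hτ)
  rcases hsign with h | h
  · exact volume_sublevel_le_of_le_deriv hD hf hτ h s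
  · exact volume_sublevel_le_of_deriv_le hD hf hτ h s

/-! ### Second order -/

/-- **Second-order sublevel estimate (van der Corput type)**: if `f'' ≥ c > 0` on a convex
`D ⊆ ℝ` (with `f' ` the derivative of `f` and `f''` that of `f'` on `D`), then for `s > 0`,
`vol {x ∈ D | |f x| < s} ≤ 6 √(s/c)`. Proof: with `τ = √(sc)`, the set `{x ∈ D | |f' x| < τ}`
has measure `≤ 2τ/c` (first-order estimate for `f'`), and on each of the two convex pieces
`{f' ≥ τ}`, `{f' ≤ -τ}` the first-order estimate for `f` gives `≤ 2s/τ`. [folklore] -/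
theorem volume_sublevel_le_of_le_deriv2 {D : Set ℝ} (hD : Convex ℝ D) {f f' f'' : ℝ → ℝ}
    (hf : ∀ x ∈ D, HasDerivAt f (f' x) x) (hf' : ∀ x ∈ D, HasDerivAt f' (f'' x) x)
    {c : ℝ} (hc : 0 < c) (hle : ∀ x ∈ D, c ≤ f'' x) {s : ℝ} (hs : 0 < s) :
    volume {x ∈ D | |f x| < s} ≤ ENNReal.ofReal (6 * Real.sqrt (s / c)) := by
  set τ : ℝ := Real.sqrt (s * c) with hτ
  have hτ0 : 0 < τ := Real.sqrt_pos.2 (by positivity)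
  -- the three pieces
  set Dp : Set ℝ := {x ∈ D | τ ≤ f' x} with hDp
  set Dm : Set ℝ := {x ∈ D | f' x ≤ -τ} with hDm
  set D0 : Set ℝ := {x ∈ D | |f' x| < τ} with hD0
  -- `f'` is monotone on `D`, so `Dp`, `Dm` are convex
  have hmono : MonotoneOn f' D := by
    have hcont : ContinuousOn f' D := fun z hz => (hf' z hz).continuousAt.continuousWithinAt
    have hdiff : DifferentiableOn ℝ f' (interior D) := fun z hz =>
      (hf' z (interior_subset hz)).differentiableAt.differentiableWithinAt
    refine monotoneOn_of_deriv_nonneg hD hcont hdiff fun z hz => ?_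
    rw [(hf' z (interior_subset hz)).deriv]
    exact (hc.trans_le (hle z (interior_subset hz))).le
  have hDpc : Convex ℝ Dp := by
    refine convex_iff_ordConnected.2 ⟨fun x hx y hy z hz => ⟨hD.ordConnected.out hx.1 hy.1 hz, ?_⟩⟩
    exact hx.2.trans (hmono hx.1 (hD.ordConnected.out hx.1 hy.1 hz) hz.1)
  have hDmc : Convex ℝ Dm := by
    refine convex_iff_ordConnected.2 ⟨fun x hx y hy z hz => ⟨hD.ordConnected.out hx.1 hy.1 hz, ?_⟩⟩
    exact (hmono (hD.ordConnected.out hx.1 hy.1 hz) hy.1 hz.2).trans hy.2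
  -- the measures of the pieces
  have hP : volume {x ∈ Dp | |f x| < s} ≤ ENNReal.ofReal (2 * s / τ) :=
    volume_sublevel_le_of_le_deriv hDpc (fun x hx => hf x hx.1) hτ0 (fun x hx => hx.2) s
  have hM : volume {x ∈ Dm | |f x| < s} ≤ ENNReal.ofReal (2 * s / τ) :=
    volume_sublevel_le_of_deriv_le hDmc (fun x hx => hf x hx.1) hτ0 (fun x hx => hx.2) s
  have h0 : volume D0 ≤ ENNReal.ofReal (2 * τ / c) :=
    volume_sublevel_le_of_le_deriv hD hf' hc hle τ
  -- cover and add
  have hcover : {x ∈ D | |f x| < s} ⊆ ({x ∈ Dp | |f x| < s} ∪ {x ∈ Dm | |f x| < s}) ∪ D0 := by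
    intro x hx
    by_cases h1 : τ ≤ f' x
    · exact Or.inl (Or.inl ⟨⟨hx.1, h1⟩, hx.2⟩)
    by_cases h2 : f' x ≤ -τ
    · exact Or.inl (Or.inr ⟨⟨hx.1, h2⟩, hx.2⟩)
    · push Not at h1 h2
      exact Or.inr ⟨hx.1, abs_lt.2 ⟨h2, h1⟩⟩
  have hsum : 2 * s / τ + 2 * s / τ + 2 * τ / c = 6 * Real.sqrt (s / c) := by
    have hss : Real.sqrt s * Real.sqrt s = s := Real.mul_self_sqrt hs.le
    have hcc : Real.sqrt c * Real.sqrt c = c := Real.mul_self_sqrt hc.le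
    have hs0 : 0 < Real.sqrt s := Real.sqrt_pos.2 hs
    have hc0 : 0 < Real.sqrt c := Real.sqrt_pos.2 hc
    have e1 : s / τ = Real.sqrt s / Real.sqrt c := by
      rw [hτ, Real.sqrt_mul hs.le, div_eq_div_iff (by positivity) hc0.ne']
      rw [← mul_assoc, hss]
    have e2 : τ / c = Real.sqrt s / Real.sqrt c := by
      rw [hτ, Real.sqrt_mul hs.le, div_eq_div_iff hc.ne' hc0.ne']
      rw [mul_assoc, hcc]
    rw [Real.sqrt_div hs.le, mul_div_assoc, mul_div_assoc, e1, e2]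
    ring
  calc volume {x ∈ D | |f x| < s}
      ≤ volume (({x ∈ Dp | |f x| < s} ∪ {x ∈ Dm | |f x| < s}) ∪ D0) := measure_mono hcover
    _ ≤ volume {x ∈ Dp | |f x| < s} + volume {x ∈ Dm | |f x| < s} + volume D0 :=
        (measure_union_le _ _).trans (by gcongr; exact measure_union_le _ _)
    _ ≤ ENNReal.ofReal (2 * s / τ) + ENNReal.ofReal (2 * s / τ) + ENNReal.ofReal (2 * τ / c) :=
        add_le_add (add_le_add hP hM) h0
    _ = ENNReal.ofReal (6 * Real.sqrt (s / c)) := by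
        rw [← ENNReal.ofReal_add (by positivity) (by positivity),
          ← ENNReal.ofReal_add (by positivity) (by positivity), hsum]

/-- Second-order sublevel estimate, concave case: `f'' ≤ -c < 0` on `D`. [folklore] -/
theorem volume_sublevel_le_of_deriv2_le {D : Set ℝ} (hD : Convex ℝ D) {f f' f'' : ℝ → ℝ}
    (hf : ∀ x ∈ D, HasDerivAt f (f' x) x) (hf' : ∀ x ∈ D, HasDerivAt f' (f'' x) x)
    {c : ℝ} (hc : 0 < c) (hle : ∀ x ∈ D, f'' x ≤ -c) {s : ℝ} (hs : 0 < s) :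
    volume {x ∈ D | |f x| < s} ≤ ENNReal.ofReal (6 * Real.sqrt (s / c)) := by
  have h := volume_sublevel_le_of_le_deriv2 hD (f := fun x => -f x) (f' := fun x => -f' x)
    (f'' := fun x => -f'' x) (fun x hx => (hf x hx).neg) (fun x hx => (hf' x hx).neg) hc
    (fun x hx => by linarith [hle x hx]) hs
  have hset : {x ∈ D | |(fun x => -f x) x| < s} = {x ∈ D | |f x| < s} := by
    ext x; simp only [mem_setOf_eq, abs_neg]
  rwa [hset] at h

/-- **Second-order sublevel estimate for `|f''| ≥ c`** with `f''` continuous on the convex `D`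
(constant sign by connectedness): `vol {x ∈ D | |f x| < s} ≤ 6 √(s/c)`. [folklore] -/
theorem volume_sublevel_le_of_le_abs_deriv2 {D : Set ℝ} (hD : Convex ℝ D) {f f' f'' : ℝ → ℝ}
    (hf : ∀ x ∈ D, HasDerivAt f (f' x) x) (hf' : ∀ x ∈ D, HasDerivAt f' (f'' x) x)
    (hf''c : ContinuousOn f'' D) {c : ℝ} (hc : 0 < c) (hle : ∀ x ∈ D, c ≤ |f'' x|) {s : ℝ} (hs : 0 < s) :
    volume {x ∈ D | |f x| < s} ≤ ENNReal.ofReal (6 * Real.sqrt (s / c)) := by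
  rcases D.eq_empty_or_nonempty with hDe | ⟨x₀, hx₀⟩
  · have : {x ∈ D | |f x| < s} = ∅ := by rw [hDe]; ext; simp
    rw [this, measure_empty]; exact bot_le
  have hpre : IsPreconnected D := hD.isPreconnected
  have hsign : (∀ x ∈ D, c ≤ f'' x) ∨ (∀ x ∈ D, f'' x ≤ -c) := by
    rcases le_or_gt 0 (f'' x₀) with h0 | h0
    · left
      intro x hx
      have hx' := hle x hx
      by_contra hneg
      push Not at hneg
      have hfx : f'' x < 0 := by
        rcases le_or_gt 0 (f'' x) with h | h
        · rw [abs_of_nonneg h] at hx'; exact absurd hx' (not_le.2 hneg)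
        · exact h
      obtain ⟨z, hz, hz0⟩ := hpre.intermediate_value₂ hx hx₀ hf''c continuousOn_const hfx.le h0
      have := hle z hz
      rw [hz0, abs_zero] at this
      exact absurd this (not_le.2 hc)
    · right
      intro x hx
      have hx' := hle x hx
      by_contra hneg
      push Not at hneg
      have hfx : 0 < f'' x := by
        rcases le_or_gt (f'' x) 0 with h | h
        · rw [abs_of_nonpos h] at hx'; linarith
        · exact h
      obtain ⟨z, hz, hz0⟩ := hpre.intermediate_value₂ hx₀ hx hf''c continuousOn_const h0.le hfx.le
      have := hle z hz
      rw [hz0, abs_zero] at this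
      exact absurd this (not_le.2 hc)
  rcases hsign with h | h
  · exact volume_sublevel_le_of_le_deriv2 hD hf hf' hc h hs
  · exact volume_sublevel_le_of_deriv2_le hD hf hf' hc h hs

end Literature.Analysis.Fourier

end
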